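import Summits.CriticalPhenomena.PercolationContinuityZ3.Theorems.PercNearOneGluingNoHeavyQuantDepthOneRows
import Summits.CriticalPhenomena.PercolationContinuityZ3.Theorems.PercNearOneGluingNoHeavyQuantSliceTwoRowRates
import HarnessLib

/-!
# QUANT lane R8, the node G₁ (`LawDec.TLC2GateConvTLC`) for a GENERAL partner, part 1: the SHIFTED-TARGET DECOMPOSITION of a
# product top-low-capacity row, target monotonicity of the row, and the NO-LOW-PARTNER case of G₁ at `q = 1`

builds on p205010 (kernel theorem, internal audit signed; external expert review pending)

Support file (`--supports stmt-CriticalPhenomena-4575`), QUANT lane seat prim-quant-arm-2 (gen 40), rung R8 of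
`run/shared/lean/prim/quant/LADDER.md`; memo `run/shared/lean/prim/quant/prim-quant-arm-2-g40/G1-GENERAL-G40.md`.  Theorems only
(no definitions), standard axioms, no sorries.  Continues census-2 g64's `…QuantDepthOneRows` (`LawDec.TLC`) / `…QuantDepthTwoClosure`
(`@[conjecture] LawDec.TLC2GateConvTLC` = G₁) and the RELAY case of G₁ (census-2 g67 `…QuantDepthTwoRelayRow*`, arm-2 g39
`…QuantDepthTwoRelayTilt/NewTop`).

THE IDENTITY (any partner).  Floor `0 < y < 1` (`u = y/(1−y)`), laws `μ₁` on `{0..M₁}`, `μ₂` on `{0..M₂}`, product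
`ν = lconv M₁ M₂ μ₁ μ₂`, target `T = T₁ + T₂`.  Write the single-threshold (top-low-capacity) row `(j, i)` of a law at floor `y`, target `τ`
in functional form `Σ_h C_τ^{j,i}(h)·ν(h) ≤ 0`,
  `C_τ^{j,i}(h) = u[h ≤ i] − [j+1 ≤ h] − u[h ≤ j ∧ τ < i+h]/usage y τ j i h`
(the body of `LawDec.TLC`; bridge `tlc_functional_sum`).  Testing it against the convolution (`sum_fun_mul_lconv`) gives
`Σ_h C_T^{j,i}(h) ν(h) = Σ_k μ₂(k) · Σ_a μ₁(a) C_T^{j,i}(a+k)`, and for every `k ≤ i` (**`tlcCoef_shift`**)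
  `C_T^{j,i}(a + k) = C_{T − 2k}^{j−k, i−k}(a)`   for every `a`
— the `k`-th term of the pull-back IS the factor-shaped row `(j−k, i−k)` of `μ₁` at the SHIFTED TARGET `T − 2k` (the minimal gate of the
pair `(i, a+k)` at `T` and of `(i−k, a)` at `T−2k` have the same `ρ = (T−2i)/(a+k−i)`; lows, giants and compatibility shift alike); for `k > i`
the term has no lows and is `≤ 0` coefficientwise (`tlcCoef_nonpos_of_lt`).  The row coefficient is MONOTONE in the target
(**`tlcCoef_mono_target`**: `τ ≤ τ′ ⟹ C_τ ≤ C_τ′`, because `pairGate` rises and compatibility shrinks with the target), so every term with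
`T − 2k ≤ T₁`, i.e. `2k ≥ T₂` — `k` NOT a low of the partner — is dominated by the genuine row `(j−k, i−k)` of `μ₁` at its own target `T₁`
(a hypothesis row below the top, Theorem A `decAt_of_top_le` at layers `≥ M₁`).  Consequences (this file):
* **`lconv_tlcRow_functional_of_noLow`** — if `μ₂ ≥ 0` has no atom `k` with `2k < T₂` then EVERY product row `(j, i)`, `i ≤ j`, `2i < T₁+T₂`,
  follows from the rows of `μ₁ ≥ 0` at target `T₁` (all layers), with NO hypothesis on `μ₂` beyond its sign and NO mean / mass / top-affordability;
* **`tlc_lconv_of_noLow_right`** — the `LawDec.TLC` form: `μ₁` a top-affordable probability law with `TLC y T₁ M₁ μ₁` (`T₁` its mean), `μ₂ ≥ 0`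
  without lows below `T₂/2` ⟹ `TLC y (T₁+T₂) (M₁+M₂) (lconv M₁ M₂ μ₁ μ₂)`;
* **`tlc2GateConvTLC_case_noLow`** — the binder of `LawDec.TLC2GateConvTLC` at `q = 1` with a no-low partner (its `TLC2` hypotheses unused).
So the whole content of G₁ (general partner) sits in the partner's LOW atoms `2k < T₂`, whose terms live at targets ABOVE `T₁`; for the relay
`{0: 1−g, 1: g}` that is the single atom `k = 0` at target `T₁ + g`, handled by census-2 g67 / arm-2 g39 with ONE `TLC2` row plus tilts.
EXACT EVIDENCE for the general node (memo §2–§4; kit j228103/j228104 two-free-factor alternating adversary FMODE=d2, kit j228161 certificate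
anatomy: 31 562 product rows in 288 cells, 23 825 pure-tilt, 7 676 pure `TLC`-mixtures of `μ₁` rows WITHOUT tilt, 61 needing `TLC2` rows, 0 failures).
HONEST STATUS: G₁ (`TLC2GateConvTLC`), SGC and `Quant.FarTreeRow` (light) remain OPEN; nothing here is cited as a published result; the lane's
RATE class log\* and honest sentence (`run/shared/lean/prim/quant/README.md`) are unchanged.

[this work]; the test-function identity for `lconv` is arm-2 g38's `sum_fun_mul_lconv` (`…QuantTwoLayerCertificate`, restated privately
here because that module's olean is not yet built on the farm); `pairGate_raise_target`: prim-quant-lead g22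
(`…QuantSliceTwoRowRates`); `TLC`, `tlc_of_flowAtT`: prim-quant-census-2 g64; flows / usage: prim-quant-stmt g22 (this lane).  The gluing rows
served [cite: KozmaNitzan2024, Conjecture 3 (p. 15)]; product measure [cite: Grimmett1999, §1.3 p. 10].
-/

noncomputable section

namespace Summit.CriticalPhenomena.PercolationContinuityZ3.Theorems

namespace Quant

open Finset

namespace LawDec

/-! ### Bookkeeping -/

/-- a test function against the convolution: `Σ_{h ≤ M₁+M₂} φ h·lconv μ₁ μ₂ h = Σ_{a ≤ M₁} Σ_{s ≤ M₂} φ(a+s)·μ₁ a·μ₂ s`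
(= `sum_fun_mul_lconv` of `…QuantTwoLayerCertificate`, arm-2 g38; private copy). -/
private theorem sum_fun_mul_lconv' (M₁ M₂ : ℕ) (μ₁ μ₂ : ℕ → ℝ) (φ : ℕ → ℝ) :
    ∑ h ∈ Finset.range (M₁ + M₂ + 1), φ h * lconv M₁ M₂ μ₁ μ₂ h
      = ∑ a ∈ Finset.range (M₁ + 1), ∑ s ∈ Finset.range (M₂ + 1), φ (a + s) * (μ₁ a * μ₂ s) := by
  simp only [lconv, Finset.mul_sum]
  rw [Finset.sum_comm]
  refine Finset.sum_congr rfl fun a ha => ?_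
  rw [Finset.sum_comm]
  refine Finset.sum_congr rfl fun s hs => ?_
  rw [Finset.mem_range] at ha hs
  have e : ∀ h : ℕ, φ h * (if a + s = h then μ₁ a * μ₂ s else 0) = if a + s = h then φ (a + s) * (μ₁ a * μ₂ s) else 0 := by
    intro h
    split_ifs with hh
    · rw [hh]
    · rw [mul_zero]
  simp_rw [e]
  rw [Finset.sum_ite_eq (Finset.range (M₁ + M₂ + 1)) (a + s), if_pos (Finset.mem_range.2 (by omega))]

/-! ### The functional form of a single-threshold row -/

/-- **bridge**: the functional form of the `TLC` row `(j, i)` at `(y, τ)` on `{0..N}` (`i ≤ N`):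
`Σ_{h ≤ N} C_τ^{j,i}(h)·ν h = u·ν{≤ i} − ν{> j} − u·Σ_{h ≤ j, τ < i+h} ν h/usage`. [this work] -/
theorem tlc_functional_sum (y τ : ℝ) (N i j : ℕ) (ν : ℕ → ℝ) (hiN : i ≤ N) :
    ∑ h ∈ Finset.range (N + 1), (y / (1 - y) * (if h ≤ i then (1 : ℝ) else 0) - (if j + 1 ≤ h then (1 : ℝ) else 0)
        - y / (1 - y) * (if h ≤ j ∧ τ < (i : ℝ) + h then 1 / usage y τ j i h else 0)) * ν h
      = y / (1 - y) * ∑ l ∈ Finset.range (i + 1), ν l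
        - ∑ h ∈ Finset.range (N + 1), (if j + 1 ≤ h then ν h else 0)
        - y / (1 - y) * ∑ h ∈ Finset.range (N + 1), (if h ≤ j ∧ τ < (i : ℝ) + h then ν h / usage y τ j i h else 0) := by
  have e1 : ∑ h ∈ Finset.range (N + 1), (y / (1 - y) * (if h ≤ i then (1 : ℝ) else 0)) * ν h
      = y / (1 - y) * ∑ l ∈ Finset.range (i + 1), ν l := by
    have hsplit : ∑ h ∈ Finset.range (N + 1), (if h ≤ i then ν h else 0) = ∑ l ∈ Finset.range (i + 1), ν l := by
      rw [← Finset.sum_range_add_sum_Ico _ (show i + 1 ≤ N + 1 by omega)]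
      rw [Finset.sum_eq_zero (s := Finset.Ico (i + 1) (N + 1)) (fun h hh => by
        rw [Finset.mem_Ico] at hh; rw [if_neg (by omega)]), add_zero]
      exact Finset.sum_congr rfl fun h hh => by
        rw [Finset.mem_range] at hh; rw [if_pos (by omega)]
    rw [← hsplit, Finset.mul_sum]
    exact Finset.sum_congr rfl fun h _ => by split_ifs <;> ring
  have e2 : ∑ h ∈ Finset.range (N + 1), (if j + 1 ≤ h then (1 : ℝ) else 0) * ν h
      = ∑ h ∈ Finset.range (N + 1), (if j + 1 ≤ h then ν h else 0) :=
    Finset.sum_congr rfl fun h _ => by split_ifs <;> ring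
  have e3 : ∑ h ∈ Finset.range (N + 1), (y / (1 - y) * (if h ≤ j ∧ τ < (i : ℝ) + h then 1 / usage y τ j i h else 0)) * ν h
      = y / (1 - y) * ∑ h ∈ Finset.range (N + 1), (if h ≤ j ∧ τ < (i : ℝ) + h then ν h / usage y τ j i h else 0) := by
    rw [Finset.mul_sum]
    exact Finset.sum_congr rfl fun h _ => by split_ifs <;> ring
  rw [← e1, ← e2, ← e3, ← Finset.sum_sub_distrib, ← Finset.sum_sub_distrib]
  exact Finset.sum_congr rfl fun h _ => by ring

/-! ### The shifted-target identity -/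

/-- **SHIFTED TARGET**: for `k ≤ i ≤ j`, the coefficient of the row `(j, i)` at target `T` at the atom `a + k` is the coefficient of the
row `(j − k, i − k)` at target `T − 2k` at the atom `a` (same floor): lows `a + k ≤ i ⟺ a ≤ i−k`, giants `j+1 ≤ a+k ⟺ (j−k)+1 ≤ a`,
compatibility `T < i + (a+k) ⟺ T − 2k < (i−k) + a`, and the SAME minimal gate: `ρ = (T − 2i)/(a+k−i) = ((T−2k) − 2(i−k))/(a − (i−k))`. [this work] -/
theorem tlcCoef_shift (y T : ℝ) (j i k a : ℕ) (hki : k ≤ i) (hij : i ≤ j) :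
    y / (1 - y) * (if a + k ≤ i then (1 : ℝ) else 0) - (if j + 1 ≤ a + k then (1 : ℝ) else 0)
        - y / (1 - y) * (if a + k ≤ j ∧ T < (i : ℝ) + ((a + k : ℕ) : ℝ) then 1 / usage y T j i (a + k) else 0)
      = y / (1 - y) * (if a ≤ i - k then (1 : ℝ) else 0) - (if i - k ≤ j - k ∧ j - k + 1 ≤ a then (1 : ℝ) else 0)
        - y / (1 - y) * (if a ≤ j - k ∧ T - 2 * (k : ℝ) < ((i - k : ℕ) : ℝ) + a
            then 1 / usage y (T - 2 * (k : ℝ)) (j - k) (i - k) a else 0) := by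
  have hik : ((i - k : ℕ) : ℝ) = (i : ℝ) - k := Nat.cast_sub hki
  have hak : ((a + k : ℕ) : ℝ) = (a : ℝ) + k := Nat.cast_add a k
  have husage : usage y T j i (a + k) = usage y (T - 2 * (k : ℝ)) (j - k) (i - k) a := by
    have hρ : (T - 2 * (i : ℝ)) / (((a + k : ℕ) : ℝ) - i)
        = (T - 2 * (k : ℝ) - 2 * ((i - k : ℕ) : ℝ)) / ((a : ℝ) - ((i - k : ℕ) : ℝ)) := by
      rw [hak, hik]; ring_nf
    have hg : pairGate y T i (a + k) = pairGate y (T - 2 * (k : ℝ)) (i - k) a := by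
      unfold pairGate; rw [hρ]
    by_cases hja : j + 1 ≤ a + k
    · have hja' : j - k + 1 ≤ a := by omega
      simp only [usage, gateOf, if_pos hja, if_pos hja']
    · have hja' : ¬ (j - k + 1 ≤ a) := by omega
      simp only [usage, gateOf, if_neg hja, if_neg hja', hg]
  have i1 : (a + k ≤ i) ↔ (a ≤ i - k) := by omega
  have i2 : (j + 1 ≤ a + k) ↔ (i - k ≤ j - k ∧ j - k + 1 ≤ a) := by omega
  have i3 : (a + k ≤ j ∧ T < (i : ℝ) + ((a + k : ℕ) : ℝ)) ↔ (a ≤ j - k ∧ T - 2 * (k : ℝ) < ((i - k : ℕ) : ℝ) + a) := by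
    rw [hak, hik]
    constructor
    · rintro ⟨h1, h2⟩; exact ⟨by omega, by linarith⟩
    · rintro ⟨h1, h2⟩; exact ⟨by omega, by linarith⟩
  rw [if_congr i1 rfl rfl, if_congr i2 rfl rfl, if_congr i3 (by rw [husage]) rfl]

/-! ### Monotonicity in the target and the sign of a low-free term -/

/-- **the row coefficient is MONOTONE in the target**: `0 < y < 1`, `2i < τ ≤ τ′` ⟹ `C_τ^{j,i}(a) ≤ C_{τ′}^{j,i}(a)` for every `a` — a larger
target has fewer compatible mids and a larger minimal gate (`pairGate_raise_target`), hence smaller capacities `1/usage`. [this work] -/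
theorem tlcCoef_mono_target (y τ τ' : ℝ) (j i a : ℕ) (hy0 : 0 < y) (hy1 : y < 1) (hlow : 2 * (i : ℝ) < τ) (hττ : τ ≤ τ') :
    y / (1 - y) * (if a ≤ i then (1 : ℝ) else 0) - (if j + 1 ≤ a then (1 : ℝ) else 0)
        - y / (1 - y) * (if a ≤ j ∧ τ < (i : ℝ) + a then 1 / usage y τ j i a else 0)
      ≤ y / (1 - y) * (if a ≤ i then (1 : ℝ) else 0) - (if j + 1 ≤ a then (1 : ℝ) else 0)
        - y / (1 - y) * (if a ≤ j ∧ τ' < (i : ℝ) + a then 1 / usage y τ' j i a else 0) := by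
  have h1y : 0 < 1 - y := by linarith
  have hu0 : 0 < y / (1 - y) := div_pos hy0 h1y
  have key : (if a ≤ j ∧ τ' < (i : ℝ) + a then 1 / usage y τ' j i a else 0)
      ≤ (if a ≤ j ∧ τ < (i : ℝ) + a then 1 / usage y τ j i a else 0) := by
    by_cases hc' : a ≤ j ∧ τ' < (i : ℝ) + a
    · have hc : a ≤ j ∧ τ < (i : ℝ) + a := ⟨hc'.1, lt_of_le_of_lt hττ hc'.2⟩
      rw [if_pos hc', if_pos hc]
      have hia : i < a := by
        have : (i : ℝ) < a := by linarith [hc.2]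
        exact_mod_cast this
      have hpos : 0 < usage y τ j i a := usage_pos_of_compat y τ j i a hy0 hy1 hlow hia (Or.inr hc.2)
      have hnj : ¬ (j + 1 ≤ a) := by omega
      have hG : pairGate y τ i a ≤ pairGate y τ' i a := pairGate_raise_target y τ τ' i a hy1.le hia hττ
      have hG1 : pairGate y τ' i a < 1 := pairGate_lt_one y τ' i a hy0 hy1 (by linarith) hc'.2
      have hle : usage y τ j i a ≤ usage y τ' j i a := by
        simp only [usage, gateOf, if_neg hnj]
        have e : ∀ t : ℝ, t < 1 → t / (1 - t) = 1 / (1 - t) - 1 := by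
          intro t ht
          have : 1 - t ≠ 0 := by intro h0; linarith
          field_simp
          ring
        rw [e _ (lt_of_le_of_lt hG hG1), e _ hG1]
        have := one_div_le_one_div_of_le (show 0 < 1 - pairGate y τ' i a by linarith) (show 1 - pairGate y τ' i a ≤ 1 - pairGate y τ i a by linarith)
        linarith
      exact one_div_le_one_div_of_le hpos hle
    · rw [if_neg hc']
      split_ifs with hc
      · have hia : i < a := by
          have : (i : ℝ) < a := by linarith [hc.2]
          exact_mod_cast this
        exact div_nonneg zero_le_one (usage_pos_of_compat y τ j i a hy0 hy1 hlow hia (Or.inr hc.2)).le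
      · exact le_rfl
  have := mul_le_mul_of_nonneg_left key hu0.le
  linarith

/-- **a term without lows is nonpositive**: for an atom `n > i` the coefficient `C_T^{j,i}(n)` is `≤ 0` (`0 < y < 1`, `2i < T`). [this work] -/
theorem tlcCoef_nonpos_of_lt (y T : ℝ) (j i n : ℕ) (hy0 : 0 < y) (hy1 : y < 1) (hlow : 2 * (i : ℝ) < T) (hn : i < n) :
    y / (1 - y) * (if n ≤ i then (1 : ℝ) else 0) - (if j + 1 ≤ n then (1 : ℝ) else 0)
        - y / (1 - y) * (if n ≤ j ∧ T < (i : ℝ) + n then 1 / usage y T j i n else 0) ≤ 0 := by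
  have h1y : 0 < 1 - y := by linarith
  have hu0 : 0 < y / (1 - y) := div_pos hy0 h1y
  have hni : ¬ (n ≤ i) := by omega
  rw [if_neg hni, mul_zero]
  have hA : 0 ≤ (if j + 1 ≤ n then (1 : ℝ) else 0) := by split_ifs <;> norm_num
  have hB : 0 ≤ (if n ≤ j ∧ T < (i : ℝ) + n then 1 / usage y T j i n else 0) := by
    split_ifs with hc
    · exact div_nonneg zero_le_one (usage_pos_of_compat y T j i n hy0 hy1 hlow hn (Or.inr hc.2)).le
    · exact le_rfl
  have := mul_nonneg hu0.le hB
  linarith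

/-! ### The no-low-partner case of G₁, functional form -/

/-- **PRODUCT SINGLE-THRESHOLD ROWS FROM THE BIG FACTOR'S ROWS WHEN THE PARTNER HAS NO LOWS** (functional form).  `0 < y < 1`;
`μ₁ ≥ 0` satisfies, in functional form, every single-threshold row `(j′, i′)` (`i′ ≤ j′`, `2i′ < T₁`) at target `T₁` on `{0..M₁}` (ALL layers
`j′`); `μ₂ ≥ 0` has no atom `k` with `2k < T₂`.  Then `lconv M₁ M₂ μ₁ μ₂` satisfies, in functional form, every single-threshold row `(j, i)`,
`i ≤ j`, `2i < T₁ + T₂`, at target `T₁ + T₂` on `{0..M₁+M₂}`.  Proof: the test-function identity for `lconv`, then termwise in `k`: `k ≤ i` by `tlcCoef_shift` +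
`tlcCoef_mono_target` (`T₁ + T₂ − 2k ≤ T₁`) + the hypothesis row `(j−k, i−k)`; `k > i` by `tlcCoef_nonpos_of_lt`.  No mean, mass or
top-affordability of either law is used. [this work] -/
theorem lconv_tlcRow_functional_of_noLow (y T₁ T₂ : ℝ) (M₁ M₂ j i : ℕ) (μ₁ μ₂ : ℕ → ℝ)
    (hy0 : 0 < y) (hy1 : y < 1) (h10 : ∀ a, 0 ≤ μ₁ a) (h20 : ∀ k, 0 ≤ μ₂ k)
    (hnolow : ∀ k : ℕ, 2 * (k : ℝ) < T₂ → μ₂ k = 0)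
    (hrows : ∀ j' i' : ℕ, i' ≤ j' → 2 * (i' : ℝ) < T₁ →
      ∑ a ∈ Finset.range (M₁ + 1), (y / (1 - y) * (if a ≤ i' then (1 : ℝ) else 0) - (if j' + 1 ≤ a then (1 : ℝ) else 0)
        - y / (1 - y) * (if a ≤ j' ∧ T₁ < (i' : ℝ) + a then 1 / usage y T₁ j' i' a else 0)) * μ₁ a ≤ 0)
    (hij : i ≤ j) (hlow : 2 * (i : ℝ) < T₁ + T₂) :
    ∑ h ∈ Finset.range (M₁ + M₂ + 1), (y / (1 - y) * (if h ≤ i then (1 : ℝ) else 0) - (if j + 1 ≤ h then (1 : ℝ) else 0)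
        - y / (1 - y) * (if h ≤ j ∧ T₁ + T₂ < (i : ℝ) + h then 1 / usage y (T₁ + T₂) j i h else 0))
        * lconv M₁ M₂ μ₁ μ₂ h ≤ 0 := by
  rw [sum_fun_mul_lconv', Finset.sum_comm]
  refine Finset.sum_nonpos fun k _ => ?_
  -- the term of the partner atom `k`
  have hre : ∀ (c : ℝ) (a : ℕ), c * (μ₁ a * μ₂ k) = μ₂ k * (c * μ₁ a) := fun c a => by ring
  simp_rw [hre]
  rw [← Finset.mul_sum]
  rcases (h20 k).eq_or_lt with hk0 | hkpos
  · rw [← hk0, zero_mul]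
  have hk2 : T₂ ≤ 2 * (k : ℝ) := by
    by_contra hlt
    exact hkpos.ne' (hnolow k (lt_of_not_ge hlt))
  have hinner : ∑ a ∈ Finset.range (M₁ + 1),
      (y / (1 - y) * (if a + k ≤ i then (1 : ℝ) else 0) - (if j + 1 ≤ a + k then (1 : ℝ) else 0)
        - y / (1 - y) * (if a + k ≤ j ∧ T₁ + T₂ < (i : ℝ) + ((a + k : ℕ) : ℝ) then 1 / usage y (T₁ + T₂) j i (a + k) else 0))
        * μ₁ a ≤ 0 := by
    by_cases hki : k ≤ i
    · -- shift to the factor-shaped row `(j - k, i - k)` at target `T₁ + T₂ - 2k ≤ T₁`, then monotonicity, then the hypothesis row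
      have hik : ((i - k : ℕ) : ℝ) = (i : ℝ) - k := Nat.cast_sub hki
      have hlow' : 2 * ((i - k : ℕ) : ℝ) < T₁ + T₂ - 2 * (k : ℝ) := by rw [hik]; linarith
      have hlow1 : 2 * ((i - k : ℕ) : ℝ) < T₁ := by linarith
      have hle : ∀ a : ℕ,
          (y / (1 - y) * (if a + k ≤ i then (1 : ℝ) else 0) - (if j + 1 ≤ a + k then (1 : ℝ) else 0)
            - y / (1 - y) * (if a + k ≤ j ∧ T₁ + T₂ < (i : ℝ) + ((a + k : ℕ) : ℝ) then 1 / usage y (T₁ + T₂) j i (a + k) else 0))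
          ≤ (y / (1 - y) * (if a ≤ i - k then (1 : ℝ) else 0) - (if j - k + 1 ≤ a then (1 : ℝ) else 0)
            - y / (1 - y) * (if a ≤ j - k ∧ T₁ < ((i - k : ℕ) : ℝ) + a then 1 / usage y T₁ (j - k) (i - k) a else 0)) := by
        intro a
        rw [tlcCoef_shift y (T₁ + T₂) j i k a hki hij]
        have hgi : (i - k ≤ j - k ∧ j - k + 1 ≤ a) ↔ (j - k + 1 ≤ a) := by omega
        rw [if_congr hgi rfl rfl]
        exact tlcCoef_mono_target y (T₁ + T₂ - 2 * (k : ℝ)) T₁ (j - k) (i - k) a hy0 hy1 hlow' (by linarith)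
      calc ∑ a ∈ Finset.range (M₁ + 1),
            (y / (1 - y) * (if a + k ≤ i then (1 : ℝ) else 0) - (if j + 1 ≤ a + k then (1 : ℝ) else 0)
              - y / (1 - y) * (if a + k ≤ j ∧ T₁ + T₂ < (i : ℝ) + ((a + k : ℕ) : ℝ) then
                  1 / usage y (T₁ + T₂) j i (a + k) else 0)) * μ₁ a
          ≤ ∑ a ∈ Finset.range (M₁ + 1),
            (y / (1 - y) * (if a ≤ i - k then (1 : ℝ) else 0) - (if j - k + 1 ≤ a then (1 : ℝ) else 0)
              - y / (1 - y) * (if a ≤ j - k ∧ T₁ < ((i - k : ℕ) : ℝ) + a then 1 / usage y T₁ (j - k) (i - k) a else 0)) * μ₁ a :=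
            Finset.sum_le_sum fun a _ => mul_le_mul_of_nonneg_right (hle a) (h10 a)
        _ ≤ 0 := hrows (j - k) (i - k) (by omega) hlow1
    · -- `k > i`: no lows in this term
      have hik : i < k := lt_of_not_ge hki
      refine Finset.sum_nonpos fun a _ => ?_
      have hn : i < a + k := by omega
      have hc := tlcCoef_nonpos_of_lt y (T₁ + T₂) j i (a + k) hy0 hy1 hlow hn
      have := mul_nonneg (neg_nonneg.2 hc) (h10 a)
      linarith
  have := mul_nonneg hkpos.le (neg_nonneg.2 hinner)
  linarith

/-! ### The no-low-partner case of G₁, row-family form -/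

/-- **every single-threshold row of a top-affordable probability law with `TLC`, at EVERY layer** (`0 < y < 1`): below the top the row is the
hypothesis `TLC y T₁ M₁ μ₁`; at layers `j′ ≥ M₁` it is Theorem A (`decAt_of_top_le`) through the flow normal form (`flowAtT_of_decAtT`,
`IsFlowAtT.lowMass_le_giants_add_midCapacity`).  Functional form. [this work] -/
theorem tlcRow_functional_all_layers (y : ℝ) (M₁ : ℕ) (μ₁ : ℕ → ℝ) (hy0 : 0 < y) (hy1 : y < 1)
    (h10 : ∀ h, 0 ≤ μ₁ h) (h1M : ∀ h, M₁ < h → μ₁ h = 0) (h11 : ∑ h ∈ Finset.range (M₁ + 1), μ₁ h = 1)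
    (h1T : y * (M₁ : ℝ) ≤ ∑ h ∈ Finset.range (M₁ + 1), (h : ℝ) * μ₁ h)
    (hTLC : TLC y (∑ h ∈ Finset.range (M₁ + 1), (h : ℝ) * μ₁ h) M₁ μ₁)
    (j' i' : ℕ) (hij : i' ≤ j') (hlow : 2 * (i' : ℝ) < ∑ h ∈ Finset.range (M₁ + 1), (h : ℝ) * μ₁ h) :
    ∑ a ∈ Finset.range (M₁ + 1), (y / (1 - y) * (if a ≤ i' then (1 : ℝ) else 0) - (if j' + 1 ≤ a then (1 : ℝ) else 0)
        - y / (1 - y) * (if a ≤ j' ∧ (∑ h ∈ Finset.range (M₁ + 1), (h : ℝ) * μ₁ h) < (i' : ℝ) + a then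
            1 / usage y (∑ h ∈ Finset.range (M₁ + 1), (h : ℝ) * μ₁ h) j' i' a else 0)) * μ₁ a ≤ 0 := by
  set T₁ : ℝ := ∑ h ∈ Finset.range (M₁ + 1), (h : ℝ) * μ₁ h with hT₁
  have hT1M : T₁ ≤ (M₁ : ℝ) := sum_mul_le_top M₁ μ₁ h10 h11
  have hiM : i' ≤ M₁ := by
    have : (i' : ℝ) ≤ M₁ := by linarith [(Nat.cast_nonneg i' : (0 : ℝ) ≤ i')]
    exact_mod_cast this
  -- the row in `TLC` (Finset) form, at any layer
  have hrow : y / (1 - y) * ∑ l ∈ Finset.range (i' + 1), μ₁ l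
      ≤ ∑ h ∈ Finset.range (M₁ + 1), (if j' + 1 ≤ h then μ₁ h else 0)
        + y / (1 - y) * ∑ h ∈ Finset.range (M₁ + 1), (if h ≤ j' ∧ T₁ < (i' : ℝ) + h then μ₁ h / usage y T₁ j' i' h else 0) := by
    rcases Nat.lt_or_ge j' M₁ with hjM | hjM
    · exact hTLC j' i' hjM hij hlow
    · -- Theorem A at layers ≥ the top
      have htop : ∀ h, 0 < μ₁ h → y * (h : ℝ) ≤ T₁ := by
        intro h hh
        have hhM : h ≤ M₁ := by
          by_contra hc
          exact hh.ne' (h1M h (by omega))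
        have : y * (h : ℝ) ≤ y * M₁ := mul_le_mul_of_nonneg_left (by exact_mod_cast hhM) hy0.le
        linarith
      have hdec : DECAt y j' M₁ μ₁ := decAt_of_top_le M₁ μ₁ h10 h1M h11 y hy1 htop j' hjM
      have hflow : FlowAtT y T₁ j' M₁ μ₁ :=
        flowAtT_of_decAtT y T₁ j' M₁ μ₁ hy0 hy1 ((decAt_iff_decAtT y j' M₁ μ₁).1 hdec)
      obtain ⟨f, hf⟩ := (flowAtT_iff_exists_isFlowAtT y T₁ j' M₁ μ₁).1 hflow
      exact hf.lowMass_le_giants_add_midCapacity hy0 hy1 i' hij hlow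
  rw [tlc_functional_sum y T₁ M₁ i' j' μ₁ hiM]
  linarith

/-- **G₁ FOR A NO-LOW PARTNER (q = 1), `LawDec.TLC` form.**  `0 < y < 1`; `μ₁` a probability law on `{0..M₁}` (nonnegative, vanishing above
`M₁`, mass `1`), top-affordable (`y·M₁ ≤ T₁`, `T₁` its mean) with all top-low-capacity rows `TLC y T₁ M₁ μ₁`; `μ₂ ≥ 0` with NO atom below
`T₂/2` (`2k < T₂ ⟹ μ₂ k = 0`; `T₂` any real, e.g. the mean of a law all of whose atoms are self-sufficient).  Then the convolution satisfies
every top-low-capacity row at target `T₁ + T₂`: `TLC y (T₁ + T₂) (M₁ + M₂) (lconv M₁ M₂ μ₁ μ₂)`.  Nothing about `μ₂` beyond its sign and the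
absence of lows is used (no mass, mean, top-affordability, `TLC` or `TLC2` of the partner). [this work] -/
theorem tlc_lconv_of_noLow_right (y T₂ : ℝ) (M₁ M₂ : ℕ) (μ₁ μ₂ : ℕ → ℝ) (hy0 : 0 < y) (hy1 : y < 1)
    (h10 : ∀ h, 0 ≤ μ₁ h) (h1M : ∀ h, M₁ < h → μ₁ h = 0) (h11 : ∑ h ∈ Finset.range (M₁ + 1), μ₁ h = 1)
    (h1T : y * (M₁ : ℝ) ≤ ∑ h ∈ Finset.range (M₁ + 1), (h : ℝ) * μ₁ h)
    (hTLC : TLC y (∑ h ∈ Finset.range (M₁ + 1), (h : ℝ) * μ₁ h) M₁ μ₁)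
    (h20 : ∀ k, 0 ≤ μ₂ k) (hnolow : ∀ k : ℕ, 2 * (k : ℝ) < T₂ → μ₂ k = 0) :
    TLC y ((∑ h ∈ Finset.range (M₁ + 1), (h : ℝ) * μ₁ h) + T₂) (M₁ + M₂) (lconv M₁ M₂ μ₁ μ₂) := by
  set T₁ : ℝ := ∑ h ∈ Finset.range (M₁ + 1), (h : ℝ) * μ₁ h with hT₁
  intro j i hjM hij hlow
  have hiN : i ≤ M₁ + M₂ := by omega
  have hfun := lconv_tlcRow_functional_of_noLow y T₁ T₂ M₁ M₂ j i μ₁ μ₂ hy0 hy1 h10 h20 hnolow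
    (fun j' i' hij' hlow' => tlcRow_functional_all_layers y M₁ μ₁ hy0 hy1 h10 h1M h11 h1T hTLC j' i' hij' hlow') hij hlow
  rw [tlc_functional_sum y (T₁ + T₂) (M₁ + M₂) i j (lconv M₁ M₂ μ₁ μ₂) hiN] at hfun
  linarith

/-- **THE NO-LOW CASE OF THE NODE `LawDec.TLC2GateConvTLC` AT `q = 1`**: in the binder of the conjecture with `q = 1` (`gate μ 1 = μ`), if the
partner `μ₂` has no atom below half its mean then the conclusion holds — from `TLC` of `μ₁` alone (the `TLC2` hypotheses and everything about
`μ₂` except its sign are unused).  The open content of G₁ is thus the partner's LOW atoms. [this work] -/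
theorem tlc2GateConvTLC_case_noLow (y : ℝ) (M₁ M₂ : ℕ) (μ₁ μ₂ : ℕ → ℝ)
    (hy0 : 0 < y) (hy1 : y < 1)
    (h10 : ∀ h, 0 ≤ μ₁ h) (h1M : ∀ h, M₁ < h → μ₁ h = 0) (h11 : ∑ h ∈ Finset.range (M₁ + 1), μ₁ h = 1)
    (h1T : y * (M₁ : ℝ) ≤ 1 * ∑ h ∈ Finset.range (M₁ + 1), (h : ℝ) * μ₁ h)
    (h20 : ∀ h, 0 ≤ μ₂ h)
    (hTLC1 : TLC y (1 * ∑ h ∈ Finset.range (M₁ + 1), (h : ℝ) * μ₁ h) M₁ (gate μ₁ 1))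
    (hnolow : ∀ k : ℕ, 2 * (k : ℝ) < ∑ h ∈ Finset.range (M₂ + 1), (h : ℝ) * μ₂ h → μ₂ k = 0) :
    TLC y (1 * ((∑ h ∈ Finset.range (M₁ + 1), (h : ℝ) * μ₁ h) + ∑ h ∈ Finset.range (M₂ + 1), (h : ℝ) * μ₂ h))
      (M₁ + M₂) (gate (lconv M₁ M₂ μ₁ μ₂) 1) := by
  rw [gate_one, one_mul]
  rw [gate_one, one_mul] at hTLC1
  rw [one_mul] at h1T
  exact tlc_lconv_of_noLow_right y _ M₁ M₂ μ₁ μ₂ hy0 hy1 h10 h1M h11 h1T hTLC1 h20 hnolow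

end LawDec

end Quant

end Summit.CriticalPhenomena.PercolationContinuityZ3.Theorems
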